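import Mathlib
import Summits.NavierStokesRegularity.NavierStokesRegularity.Theorems.SqueezeCycleMustSqueezeGronwall

/-!
# drefute evidence — `stub_twoPassGronwall` (line `outward-drift-signed-flux`, lead skeleton v1) PROVED

The abstract two-pass backward-Grönwall argument over arbitrary families `Z E : ℝ → ℝ → ℝ`, with the
stub's signature verbatim (`Drefute.stub_twoPassGronwall`).  Engine: the tree's
`Theorems.backward_gronwall_bound`; square roots are handled by `√x ≤ εx + 1/(4ε)` (no Jensen needed).
-/

noncomputable section

open MeasureTheory Set Filter Real intervalIntegral
open scoped Topology Interval

namespace Drefute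

/-- `r ≤ ε r² + 1/(4ε)` for `ε > 0` (`(2εr − 1)² ≥ 0`). -/
theorem le_eps_mul_sq (r : ℝ) {ε : ℝ} (hε : 0 < ε) : r ≤ ε * r ^ 2 + 1 / (4 * ε) := by
  have h4 : 0 < 4 * ε := by positivity
  rw [show ε * r ^ 2 + 1 / (4 * ε) = (4 * ε ^ 2 * r ^ 2 + 1) / (4 * ε) by field_simp,
    le_div_iff₀ h4]
  nlinarith [sq_nonneg (2 * ε * r - 1)]

/-- `√x ≤ εx + 1/(4ε)` for `x ≥ 0`, `ε > 0`. -/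
theorem sqrt_le_eps {x ε : ℝ} (hx : 0 ≤ x) (hε : 0 < ε) : Real.sqrt x ≤ ε * x + 1 / (4 * ε) := by
  have h := le_eps_mul_sq (Real.sqrt x) hε
  rwa [Real.sq_sqrt hx] at h

/-- `√x ≤ x + 1/4` for `x ≥ 0`. -/
theorem sqrt_le_add_quarter' {x : ℝ} (hx : 0 ≤ x) : Real.sqrt x ≤ x + 1 / 4 := by
  have h := sqrt_le_eps hx one_pos
  norm_num at h
  simpa using h

/-- One backward-Grönwall pass, abstract: if `Z` is differentiable with `Z' ≤ −cZ + K`, `K` continuous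
nonnegative with `K ≤ κ (F/R + √(F/R))` for a continuous nonnegative `F` whose unit-time integrals are
`≤ A`, and the unit-time integrals of `Z` are bounded, then
`Z s ≤ |κ| (A/R + ε A/R + 1/(4ε)) / (1 − e^{−c})` for every `ε > 0`. -/
theorem one_pass {Z K F : ℝ → ℝ} {c κ R A ε : ℝ} (hc : 0 < c) (hR : 0 < R) (hε : 0 < ε)
    (hZd : Differentiable ℝ Z) (hineq : ∀ s, deriv Z s ≤ -c * Z s + K s) (hKc : Continuous K)
    (hK0 : ∀ s, 0 ≤ K s) (hKle : ∀ s, K s ≤ κ * (F s / R + Real.sqrt (F s / R)))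
    (hFc : Continuous F) (hF0 : ∀ s, 0 ≤ F s) (hFavg : ∀ s, ∫ σ in s..(s + 1), F σ ≤ A)
    (hZavg : ∃ A', ∀ s, ∫ σ in s..(s + 1), Z σ ≤ A') (s : ℝ) :
    Z s ≤ |κ| * (A / R + ε * (A / R) + 1 / (4 * ε)) / (1 - Real.exp (-c)) := by
  -- pointwise bound on `|K|`
  have hpt : ∀ σ, |K σ| ≤ |κ| * (1 + ε) / R * F σ + |κ| / (4 * ε) := by
    intro σ
    rw [abs_of_nonneg (hK0 σ)]
    have hx : 0 ≤ F σ / R := div_nonneg (hF0 σ) hR.le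
    have hX : 0 ≤ F σ / R + Real.sqrt (F σ / R) := add_nonneg hx (Real.sqrt_nonneg _)
    have h1 : K σ ≤ |κ| * (F σ / R + Real.sqrt (F σ / R)) :=
      (hKle σ).trans (mul_le_mul_of_nonneg_right (le_abs_self κ) hX)
    have h2 : Real.sqrt (F σ / R) ≤ ε * (F σ / R) + 1 / (4 * ε) := sqrt_le_eps hx hε
    have h3 : |κ| * (F σ / R + Real.sqrt (F σ / R)) ≤ |κ| * ((1 + ε) * (F σ / R) + 1 / (4 * ε)) :=
      mul_le_mul_of_nonneg_left (by linarith) (abs_nonneg κ)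
    have h4 : |κ| * ((1 + ε) * (F σ / R) + 1 / (4 * ε)) = |κ| * (1 + ε) / R * F σ + |κ| / (4 * ε) := by
      field_simp
    linarith
  have hfi : ∀ s, IntervalIntegrable (fun σ => |K σ|) volume s (s + 1) := fun s =>
    (continuous_abs.comp hKc).intervalIntegrable _ _
  have hgc : Continuous fun σ => |κ| * (1 + ε) / R * F σ + |κ| / (4 * ε) :=
    (continuous_const.mul hFc).add continuous_const
  have hKB : ∀ s, ∫ σ in s..(s + 1), |K σ| ≤ |κ| * (A / R + ε * (A / R) + 1 / (4 * ε)) := by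
    intro s
    have hmono : ∫ σ in s..(s + 1), |K σ| ≤ ∫ σ in s..(s + 1), (|κ| * (1 + ε) / R * F σ + |κ| / (4 * ε)) :=
      intervalIntegral.integral_mono_on (μ := volume) (a := s) (b := s + 1) (by linarith) (hfi s)
        (hgc.intervalIntegrable _ _) (fun σ _ => hpt σ)
    have hf1 : IntervalIntegrable (fun σ => |κ| * (1 + ε) / R * F σ) volume s (s + 1) :=
      (continuous_const.mul hFc).intervalIntegrable _ _
    have hf2 : IntervalIntegrable (fun _ : ℝ => |κ| / (4 * ε)) volume s (s + 1) := intervalIntegrable_const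
    have hcalc : ∫ σ in s..(s + 1), (|κ| * (1 + ε) / R * F σ + |κ| / (4 * ε)) =
        |κ| * (1 + ε) / R * (∫ σ in s..(s + 1), F σ) + |κ| / (4 * ε) := by
      rw [intervalIntegral.integral_add hf1 hf2, intervalIntegral.integral_const_mul,
        intervalIntegral.integral_const, smul_eq_mul]
      ring
    have hcoef : 0 ≤ |κ| * (1 + ε) / R := div_nonneg (by positivity) hR.le
    have h5 : |κ| * (1 + ε) / R * (∫ σ in s..(s + 1), F σ) ≤ |κ| * (1 + ε) / R * A :=
      mul_le_mul_of_nonneg_left (hFavg s) hcoef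
    have h6 : |κ| * (1 + ε) / R * A + |κ| / (4 * ε) = |κ| * (A / R + ε * (A / R) + 1 / (4 * ε)) := by
      field_simp
    linarith
  exact Summit.NavierStokesRegularity.NavierStokesRegularity.Theorems.backward_gronwall_bound hc hZd hineq
    hKc hKB hZavg s

/-- A continuous nonnegative function all of whose unit-time integrals vanish is identically zero. -/
theorem eq_zero_of_unit_integrals_nonpos {f : ℝ → ℝ} (hf : Continuous f) (h0 : ∀ s, 0 ≤ f s)
    (hint : ∀ s, ∫ σ in s..(s + 1), f σ ≤ 0) (s₀ : ℝ) : f s₀ = 0 := by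
  by_contra hne
  have hpos0 : 0 < f s₀ := lt_of_le_of_ne (h0 s₀) (Ne.symm hne)
  set s : ℝ := s₀ - 1 / 2 with hs
  have hfi : IntervalIntegrable f volume s (s + 1) := hf.intervalIntegrable _ _
  have hsupp : IsOpen (Function.support f) := hf.isOpen_support
  have hmem : s₀ ∈ Function.support f ∩ Ioo s (s + 1) := by
    refine ⟨Function.mem_support.2 hne, ?_, ?_⟩ <;> rw [hs] <;> linarith
  have hμ : 0 < volume (Function.support f ∩ Ioc s (s + 1)) := by
    have h1 : 0 < volume (Function.support f ∩ Ioo s (s + 1)) :=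
      (hsupp.inter isOpen_Ioo).measure_pos volume ⟨s₀, hmem⟩
    exact lt_of_lt_of_le h1 (measure_mono (inter_subset_inter_right _ Ioo_subset_Ioc_self))
  have hae : 0 ≤ᵐ[volume.restrict (Ι s (s + 1))] f := Eventually.of_forall fun σ => h0 σ
  have hpos : 0 < ∫ σ in s..(s + 1), f σ :=
    (intervalIntegral.integral_pos_iff_support_of_nonneg_ae' hae hfi).2 ⟨by linarith, hμ⟩
  linarith [hint s]

/-- **`stub_twoPassGronwall`** — verbatim signature of the lead's stub, proved. -/
theorem stub_twoPassGronwall : ∀ (c κ κ' B : ℝ) (Z E : ℝ → ℝ → ℝ), 0 < c →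
    (∀ (ρ s : ℝ), 0 < ρ → 0 ≤ E ρ s) →
    (∀ ρ : ℝ, 0 < ρ → Continuous (E ρ)) →
    (∀ (s ρ ρ' : ℝ), 0 < ρ → ρ ≤ ρ' → E ρ s ≤ E ρ' s) →
    (∀ (s ρ : ℝ), 1 ≤ ρ → ∫ σ in s..(s + 1), E ρ σ ≤ B * ρ) →
    (∀ R : ℝ, 1 ≤ R → Differentiable ℝ (Z R) ∧ ∃ K : ℝ → ℝ, Continuous K ∧ (∀ s, 0 ≤ K s) ∧
      (∀ s, K s ≤ κ * (E (2 * R) s / R + Real.sqrt (E (2 * R) s / R))) ∧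
      ∀ s, deriv (Z R) s ≤ -c * Z R s + K s) →
    (∀ (R s : ℝ), 1 ≤ R → 0 ≤ Z R s) →
    (∀ (R R' s : ℝ), 1 ≤ R → R ≤ R' → Z R s ≤ Z R' s) →
    (∀ (R s : ℝ), 1 ≤ R → Z R s ≤ 6 * E (2 * R) s) →
    (∀ (R s : ℝ), 1 ≤ R → E R s ≤ Z R s + κ' * Real.sqrt (E (2 * R) s / R)) →
    ∀ (ρ s : ℝ), 0 < ρ → E ρ s = 0 := by
  intro c κ κ' B Z E hc hE0 hEc hEmono hEavg hbudget hZ0 hZmono hZE hEZ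
  have hq : 0 < 1 - Real.exp (-c) := by
    have : Real.exp (-c) < 1 := Real.exp_lt_one_iff.2 (by linarith)
    linarith
  -- `0 ≤ B`
  have hB : 0 ≤ B := by
    have h := hEavg 0 1 le_rfl
    have h0 : 0 ≤ ∫ σ in (0 : ℝ)..(0 + 1), E 1 σ :=
      intervalIntegral.integral_nonneg (by norm_num) fun σ _ => hE0 1 σ one_pos
    linarith
  -- unit-time integrals of `Z R` are bounded (Chebyshev input), for each `R ≥ 1`
  have hZavg : ∀ R, 1 ≤ R → ∃ A', ∀ s, ∫ σ in s..(s + 1), Z R σ ≤ A' := by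
    intro R hR
    obtain ⟨hZd, -⟩ := hbudget R hR
    have hE2c : Continuous (E (2 * R)) := hEc _ (by linarith)
    refine ⟨12 * B * R, fun s => ?_⟩
    have hf1 : IntervalIntegrable (fun σ => Z R σ) volume s (s + 1) := hZd.continuous.intervalIntegrable _ _
    have hf2 : IntervalIntegrable (fun σ => 6 * E (2 * R) σ) volume s (s + 1) :=
      (continuous_const.mul hE2c).intervalIntegrable _ _
    have hmono : ∫ σ in s..(s + 1), Z R σ ≤ ∫ σ in s..(s + 1), 6 * E (2 * R) σ :=
      intervalIntegral.integral_mono_on (μ := volume) (a := s) (b := s + 1) (by linarith) hf1 hf2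
        (fun σ _ => hZE R σ hR)
    have hcm : ∫ σ in s..(s + 1), 6 * E (2 * R) σ = 6 * ∫ σ in s..(s + 1), E (2 * R) σ :=
      intervalIntegral.integral_const_mul _ _
    have h := hEavg s (2 * R) (by linarith)
    nlinarith [hmono, hcm, h]
  -- PASS 1: `Z R s ≤ K₁` uniformly
  set K₁ : ℝ := |κ| * (2 * B + (2 * B) + 1 / 4) / (1 - Real.exp (-c)) with hK₁
  have hK₁0 : 0 ≤ K₁ := by rw [hK₁]; positivity
  have hpass1 : ∀ R s, 1 ≤ R → Z R s ≤ K₁ := by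
    intro R s hR
    obtain ⟨hZd, K, hKc, hK0, hKle, hineq⟩ := hbudget R hR
    have hR0 : 0 < R := by linarith
    have hE2c : Continuous (E (2 * R)) := hEc _ (by linarith)
    have hFavg : ∀ s, ∫ σ in s..(s + 1), E (2 * R) σ ≤ 2 * B * R := by
      intro s; have h := hEavg s (2 * R) (by linarith); linarith
    have h := one_pass (A := 2 * B * R) hc hR0 one_pos hZd hineq hKc hK0 hKle hE2c
      (fun σ => hE0 _ σ (by linarith)) hFavg (hZavg R hR) s
    have e : |κ| * (2 * B * R / R + 1 * (2 * B * R / R) + 1 / (4 * 1)) / (1 - Real.exp (-c)) = K₁ := by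
      rw [hK₁]; field_simp
    linarith [h, e.le, e.ge]
  -- time averages of `E R` are bounded uniformly in `R ≥ 1`
  set K₂ : ℝ := K₁ + |κ'| * (2 * B + 1 / 4) with hK₂
  have hK₂0 : 0 ≤ K₂ := by rw [hK₂]; positivity
  have hEavg2 : ∀ R s, 1 ≤ R → ∫ σ in s..(s + 1), E R σ ≤ K₂ := by
    intro R s hR
    have hR0 : 0 < R := by linarith
    have hERc : Continuous (E R) := hEc _ hR0
    have hE2c : Continuous (E (2 * R)) := hEc _ (by linarith)
    have hpt : ∀ σ, E R σ ≤ |κ'| / R * E (2 * R) σ + (K₁ + |κ'| / 4) := by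
      intro σ
      have hx : 0 ≤ E (2 * R) σ / R := div_nonneg (hE0 _ σ (by linarith)) hR0.le
      have h1 := hEZ R σ hR
      have h2 : κ' * Real.sqrt (E (2 * R) σ / R) ≤ |κ'| * Real.sqrt (E (2 * R) σ / R) :=
        mul_le_mul_of_nonneg_right (le_abs_self κ') (Real.sqrt_nonneg _)
      have h3 : |κ'| * Real.sqrt (E (2 * R) σ / R) ≤ |κ'| * (E (2 * R) σ / R + 1 / 4) :=
        mul_le_mul_of_nonneg_left (sqrt_le_add_quarter' hx) (abs_nonneg κ')
      have h4 : |κ'| * (E (2 * R) σ / R + 1 / 4) = |κ'| / R * E (2 * R) σ + |κ'| / 4 := by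
        field_simp
      linarith [hpass1 R σ hR]
    have hf1 : IntervalIntegrable (fun σ => E R σ) volume s (s + 1) := hERc.intervalIntegrable _ _
    have hgc : Continuous fun σ => |κ'| / R * E (2 * R) σ + (K₁ + |κ'| / 4) :=
      (continuous_const.mul hE2c).add continuous_const
    have hmono : ∫ σ in s..(s + 1), E R σ ≤ ∫ σ in s..(s + 1), (|κ'| / R * E (2 * R) σ + (K₁ + |κ'| / 4)) :=
      intervalIntegral.integral_mono_on (μ := volume) (a := s) (b := s + 1) (by linarith) hf1
        (hgc.intervalIntegrable _ _) (fun σ _ => hpt σ)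
    have hf3 : IntervalIntegrable (fun σ => |κ'| / R * E (2 * R) σ) volume s (s + 1) :=
      (continuous_const.mul hE2c).intervalIntegrable _ _
    have hf4 : IntervalIntegrable (fun _ : ℝ => K₁ + |κ'| / 4) volume s (s + 1) := intervalIntegrable_const
    have hcalc : ∫ σ in s..(s + 1), (|κ'| / R * E (2 * R) σ + (K₁ + |κ'| / 4)) =
        |κ'| / R * (∫ σ in s..(s + 1), E (2 * R) σ) + (K₁ + |κ'| / 4) := by
      rw [intervalIntegral.integral_add hf3 hf4, intervalIntegral.integral_const_mul,
        intervalIntegral.integral_const, smul_eq_mul]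
      ring
    have hcoef : 0 ≤ |κ'| / R := div_nonneg (abs_nonneg _) hR0.le
    have h5 : |κ'| / R * (∫ σ in s..(s + 1), E (2 * R) σ) ≤ |κ'| / R * (2 * B * R) := by
      refine mul_le_mul_of_nonneg_left ?_ hcoef
      have h := hEavg s (2 * R) (by linarith); linarith
    have h6 : |κ'| / R * (2 * B * R) = |κ'| * (2 * B) := by field_simp
    have : |κ'| * (2 * B) + (K₁ + |κ'| / 4) = K₂ := by rw [hK₂]; ring
    linarith
  -- PASS 2: `Z R s ≤ M / √R` for `R ≥ 1`
  set M : ℝ := |κ| * (2 * K₂ + 1 / 4) / (1 - Real.exp (-c)) with hM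
  have hM0 : 0 ≤ M := by rw [hM]; positivity
  have hpass2 : ∀ R s, 1 ≤ R → Z R s ≤ M / Real.sqrt R := by
    intro R s hR
    obtain ⟨hZd, K, hKc, hK0, hKle, hineq⟩ := hbudget R hR
    have hR0 : 0 < R := by linarith
    have hsq : 0 < Real.sqrt R := Real.sqrt_pos.2 hR0
    have hsq1 : 1 ≤ Real.sqrt R := by rw [← Real.sqrt_one]; exact Real.sqrt_le_sqrt hR
    have hsqR : Real.sqrt R * Real.sqrt R = R := Real.mul_self_sqrt hR0.le
    have hE2c : Continuous (E (2 * R)) := hEc _ (by linarith)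
    have hFavg : ∀ s, ∫ σ in s..(s + 1), E (2 * R) σ ≤ K₂ := fun s => hEavg2 (2 * R) s (by linarith)
    have h := one_pass (A := K₂) (ε := Real.sqrt R) hc hR0 hsq hZd hineq hKc hK0 hKle hE2c
      (fun σ => hE0 _ σ (by linarith)) hFavg (hZavg R hR) s
    -- `K₂/R + √R K₂/R + 1/(4√R) ≤ (2K₂ + 1/4)/√R`
    have hb : |κ| * (K₂ / R + Real.sqrt R * (K₂ / R) + 1 / (4 * Real.sqrt R)) ≤
        |κ| * (2 * K₂ + 1 / 4) / Real.sqrt R := by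
      rw [mul_div_assoc]
      refine mul_le_mul_of_nonneg_left ?_ (abs_nonneg κ)
      have e1 : Real.sqrt R * (K₂ / R) = K₂ / Real.sqrt R := by
        rw [eq_div_iff hsq.ne']
        calc Real.sqrt R * (K₂ / R) * Real.sqrt R = (Real.sqrt R * Real.sqrt R) * K₂ / R := by ring
          _ = K₂ := by rw [hsqR]; field_simp
      have e2 : 1 / (4 * Real.sqrt R) = (1 / 4) / Real.sqrt R := by field_simp
      have e3 : K₂ / R ≤ K₂ / Real.sqrt R := by
        apply div_le_div_of_nonneg_left hK₂0 hsq
        calc Real.sqrt R = Real.sqrt R * 1 := (mul_one _).symm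
          _ ≤ Real.sqrt R * Real.sqrt R := mul_le_mul_of_nonneg_left hsq1 hsq.le
          _ = R := hsqR
      rw [e1, e2]
      have : K₂ / Real.sqrt R + K₂ / Real.sqrt R + 1 / 4 / Real.sqrt R = (2 * K₂ + 1 / 4) / Real.sqrt R := by
        field_simp; ring
      linarith
    have hb' : |κ| * (K₂ / R + Real.sqrt R * (K₂ / R) + 1 / (4 * Real.sqrt R)) / (1 - Real.exp (-c)) ≤
        M / Real.sqrt R := by
      have e : M / Real.sqrt R = |κ| * (2 * K₂ + 1 / 4) / Real.sqrt R / (1 - Real.exp (-c)) := by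
        rw [hM]; ring
      rw [e]
      exact div_le_div_of_nonneg_right hb hq.le
    exact h.trans hb'
  -- `Z ≡ 0` on `R ≥ 1`
  have hZzero : ∀ R s, 1 ≤ R → Z R s = 0 := by
    intro R₀ s hR₀
    refine le_antisymm ?_ (hZ0 R₀ s hR₀)
    by_contra hzpos
    rw [not_le] at hzpos
    set z : ℝ := Z R₀ s with hz
    -- choose `T ≥ max R₀ (M/z + 1)` and `R = T²`
    set T : ℝ := max R₀ (M / z + 1) with hT
    have hT1 : 1 ≤ T := le_trans hR₀ (le_max_left _ _)
    have hT0 : 0 ≤ T := by linarith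
    have hTR : R₀ ≤ T ^ 2 := by
      calc R₀ ≤ T := le_max_left _ _
        _ = T * 1 := (mul_one _).symm
        _ ≤ T * T := mul_le_mul_of_nonneg_left hT1 hT0
        _ = T ^ 2 := (sq T).symm
    have hsqT : Real.sqrt (T ^ 2) = T := Real.sqrt_sq hT0
    have h1 : z ≤ Z (T ^ 2) s := hZmono R₀ (T ^ 2) s hR₀ hTR
    have h2 : Z (T ^ 2) s ≤ M / T := by
      have := hpass2 (T ^ 2) s (le_trans hR₀ hTR); rwa [hsqT] at this
    have hTgt : M / z + 1 ≤ T := le_max_right _ _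
    have hTpos : 0 < T := by linarith
    -- `M / T < z`
    have h3 : M / T < z := by
      rw [div_lt_iff₀ hTpos]
      have : M < z * (M / z + 1) := by
        rw [mul_add, mul_div_cancel₀ _ hzpos.ne', mul_one]; linarith
      nlinarith [mul_le_mul_of_nonneg_left hTgt hzpos.le]
    linarith
  -- finally `E ≡ 0`
  intro ρ₀ s₀ hρ₀
  have hEρc : Continuous (E ρ₀) := hEc _ hρ₀
  refine eq_zero_of_unit_integrals_nonpos hEρc (fun σ => hE0 _ σ hρ₀) (fun s => ?_) s₀
  -- `∫_s^{s+1} E ρ₀ ≤ ∫ E R ≤ |κ'| (√R K₂/R + 1/(4√R)) → 0`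
  refine le_of_forall_pos_lt_add fun δ hδ => ?_
  -- choose `R = T²` large
  set L : ℝ := |κ'| * (K₂ + 1 / 4) with hL
  have hL0 : 0 ≤ L := by rw [hL]; positivity
  set T : ℝ := max (max ρ₀ 1) (L / δ + 1) with hT
  have hT1 : 1 ≤ T := le_trans (le_max_right ρ₀ 1) (le_max_left _ _)
  have hT0 : 0 ≤ T := by linarith
  have hTpos : 0 < T := by linarith
  have hTT : T ≤ T ^ 2 := by
    calc T = T * 1 := (mul_one _).symm
      _ ≤ T * T := mul_le_mul_of_nonneg_left hT1 hT0
      _ = T ^ 2 := (sq T).symm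
  set R : ℝ := T ^ 2 with hRdef
  have hR1 : 1 ≤ R := le_trans hT1 hTT
  have hR0 : 0 < R := by linarith
  have hρR : ρ₀ ≤ R := le_trans (le_trans (le_max_left ρ₀ 1) (le_max_left _ _)) hTT
  have hsqR : Real.sqrt R = T := by rw [hRdef]; exact Real.sqrt_sq hT0
  have hERc : Continuous (E R) := hEc _ hR0
  have hE2c : Continuous (E (2 * R)) := hEc _ (by linarith)
  -- monotonicity in the radius
  have hm1 : ∫ σ in s..(s + 1), E ρ₀ σ ≤ ∫ σ in s..(s + 1), E R σ :=
    intervalIntegral.integral_mono_on (μ := volume) (a := s) (b := s + 1) (by linarith)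
      (hEρc.intervalIntegrable _ _) (hERc.intervalIntegrable _ _) (fun σ _ => hEmono σ ρ₀ R hρ₀ hρR)
  -- pointwise: `E R σ ≤ |κ'| (T E(2R)σ/R + 1/(4T))` (using `Z R σ = 0`)
  have hpt : ∀ σ, E R σ ≤ |κ'| * T / R * E (2 * R) σ + |κ'| / (4 * T) := by
    intro σ
    have hx : 0 ≤ E (2 * R) σ / R := div_nonneg (hE0 _ σ (by linarith)) hR0.le
    have h1 := hEZ R σ hR1
    rw [hZzero R σ hR1, zero_add] at h1
    have h2 : κ' * Real.sqrt (E (2 * R) σ / R) ≤ |κ'| * Real.sqrt (E (2 * R) σ / R) :=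
      mul_le_mul_of_nonneg_right (le_abs_self κ') (Real.sqrt_nonneg _)
    have h3 : |κ'| * Real.sqrt (E (2 * R) σ / R) ≤ |κ'| * (T * (E (2 * R) σ / R) + 1 / (4 * T)) :=
      mul_le_mul_of_nonneg_left (sqrt_le_eps hx hTpos) (abs_nonneg κ')
    have h4 : |κ'| * (T * (E (2 * R) σ / R) + 1 / (4 * T)) = |κ'| * T / R * E (2 * R) σ + |κ'| / (4 * T) := by
      field_simp
    linarith
  have hgc : Continuous fun σ => |κ'| * T / R * E (2 * R) σ + |κ'| / (4 * T) :=
    (continuous_const.mul hE2c).add continuous_const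
  have hm2 : ∫ σ in s..(s + 1), E R σ ≤ ∫ σ in s..(s + 1), (|κ'| * T / R * E (2 * R) σ + |κ'| / (4 * T)) :=
    intervalIntegral.integral_mono_on (μ := volume) (a := s) (b := s + 1) (by linarith)
      (hERc.intervalIntegrable _ _) (hgc.intervalIntegrable _ _) (fun σ _ => hpt σ)
  have hf3 : IntervalIntegrable (fun σ => |κ'| * T / R * E (2 * R) σ) volume s (s + 1) :=
    (continuous_const.mul hE2c).intervalIntegrable _ _
  have hf4 : IntervalIntegrable (fun _ : ℝ => |κ'| / (4 * T)) volume s (s + 1) := intervalIntegrable_const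
  have hcalc : ∫ σ in s..(s + 1), (|κ'| * T / R * E (2 * R) σ + |κ'| / (4 * T)) =
      |κ'| * T / R * (∫ σ in s..(s + 1), E (2 * R) σ) + |κ'| / (4 * T) := by
    rw [intervalIntegral.integral_add hf3 hf4, intervalIntegral.integral_const_mul,
      intervalIntegral.integral_const, smul_eq_mul]
    ring
  have hcoef : 0 ≤ |κ'| * T / R := div_nonneg (by positivity) hR0.le
  have h5 : |κ'| * T / R * (∫ σ in s..(s + 1), E (2 * R) σ) ≤ |κ'| * T / R * K₂ :=
    mul_le_mul_of_nonneg_left (hEavg2 (2 * R) s (by linarith)) hcoef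
  -- `|κ'| T K₂ / R + |κ'|/(4T) = L / T` since `R = T²`
  have h6 : |κ'| * T / R * K₂ + |κ'| / (4 * T) = L / T := by
    rw [hL, hRdef]; field_simp
  -- `L / T < δ`
  have h7 : L / T < δ := by
    rw [div_lt_iff₀ hTpos]
    have hTgt : L / δ + 1 ≤ T := le_max_right _ _
    have : L < δ * (L / δ + 1) := by
      rw [mul_add, mul_div_cancel₀ _ hδ.ne', mul_one]; linarith
    nlinarith [mul_le_mul_of_nonneg_left hTgt hδ.le]
  linarith

end Drefute
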